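import Mathlib.Analysis.SpecialFunctions.Pow.Asymptotics
import Mathlib.Analysis.SpecialFunctions.Pow.Real
import Mathlib.Analysis.Complex.ExponentialBounds
import Literature.NumberTheory.Sieve.ErdosRankinCovering
import HarnessLib

/-!
# Estimates for McCurley's covering theorem (Theorem 3 of *The smallest prime value of `xⁿ + a`*), I: side conditions and the smooth part

Topic `Literature/NumberTheory/Sieve`. Everything in this file is PROVED.

K. S. McCurley, Can. J. Math. 38 (1986), §4, covers `0 ≤ m ≤ u`,
`u = α (w/log₂ w)(log w log₃ w/log₂ w)^{d(n)}`, by congruences `mⁿ + a ≡ 0 (mod p)` with the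
primes `p < w` in three ranges: small `p ≤ y = exp(c log w log₃ w/log₂ w)` (greedy), medium
`y < p ≤ z` (`a ≡ 0`) and large `z < p < w` (one survivor each). This file and its sequel
`McCurleyCoveringRough.lean` supply the real-variable inequalities of that proof in the
parametrisation used by `Literature/NumberTheory/Sieve/McCurleyCovering.lean`. Throughout `L = log w`, `T = log L = log₂ w`,
`log T = log₃ w`, `d = d(n) ≥ 1`, and

* `F = (w/T)(L log T/T)^d` (McCurley's `u/α`), `ℓ = L log T/((d + 8) T)` (so `y = ⌊e^ℓ⌋`),
  `η = (d + 7) T/L` (Rankin's exponent `σ = 1 − η`), `z = w/4`.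

Contents:
* `McCurley.eventually_loglog` — the side conditions, eventually in `w`: `T ≥ 19`,
  `24 T^θ (log T + 3) ≤ T` (`θ = (d+7)/(d+8)`), `2(d+7) T ≤ L`, `2(d+8) T ≤ L log T`,
  `T² ≤ L log T`, and Chebyshev's `π(w) − π(w/4) ≥ w/(4 log w)`
  (`Literature.NumberTheory.Sieve.eventually_primeCounting_sub_quarter_ge`);
* `McCurley.F_bounds` — `w ≤ F`, `0 < F`, `log F ≤ L + d T`;
* `McCurley.smoothFactor_le` — `F^{1−η} exp(4(log₂ k + 4) + 4 η k^η (log k + 2)) ≤ w/(16 L)` for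
  `2 ≤ k ≤ e^ℓ + 1` (the exponent of `Literature.NumberTheory.Sieve.card_smoothNumbersUpTo_le_rankin_exp`),
  i.e. the `y`-smooth part of `[1, u]` is `≤ w/(16 log w)` — McCurley's `S₁`;
* `McCurley.ell_bounds` — `2 ≤ ℓ ≤ L/9`.

The rough part `S₂` and the size of `y = ⌊e^ℓ⌋` are in `McCurleyCoveringRough.lean`.

## References

* K. S. McCurley, Can. J. Math. 38 (1986) 925–936, §4 (pp. 932–934). [McCurley1986SmallestPrimeValue]
-/

open Finset Filter Real Asymptotics

namespace Literature.NumberTheory.Sieve.McCurley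

/-! ### The side conditions, eventually -/

/-- Real-variable form of the side conditions in `T = log₂ w`. [folklore] -/
theorem eventually_T (d : ℕ) :
    ∀ᶠ T : ℝ in atTop, 19 ≤ T ∧
      24 * T ^ (((d : ℝ) + 7) / ((d : ℝ) + 8)) * (Real.log T + 3) ≤ T ∧
      2 * ((d : ℝ) + 7) * T ≤ Real.exp T ∧
      2 * ((d : ℝ) + 8) * T ≤ Real.exp T * Real.log T ∧
      T ^ 2 ≤ Real.exp T * Real.log T := by
  set θ : ℝ := ((d : ℝ) + 7) / ((d : ℝ) + 8) with hθ
  have hd0 : (0 : ℝ) ≤ d := Nat.cast_nonneg d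
  have hθ1 : θ < 1 := by rw [hθ, div_lt_one (by linarith)]; linarith
  have hr : 0 < 1 - θ := by linarith
  -- `log T + 3 = o(T^{1-θ})`
  have ho : (fun T : ℝ => Real.log T + 3) =o[atTop] fun T => T ^ (1 - θ) := by
    refine (isLittleO_log_rpow_atTop hr).add ?_
    exact isLittleO_const_left.2 (Or.inr (tendsto_norm_atTop_atTop.comp (tendsto_rpow_atTop hr)))
  have hb := ho.def (by norm_num : (0 : ℝ) < 1 / 24)
  filter_upwards [hb, eventually_ge_atTop (19 : ℝ), eventually_ge_atTop (4 * ((d : ℝ) + 8))]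
    with T hT h19 h4d
  have hT0 : 0 < T := by linarith
  have hlogT : 1 ≤ Real.log T := by
    rw [← Real.log_exp 1]
    refine Real.log_le_log (Real.exp_pos 1) ?_
    have := Real.exp_one_lt_d9
    linarith
  -- `exp T ≥ T²/2` and `exp T ≥ T⁴/64 ≥ T²`
  have hexp2 : T ^ 2 / 2 ≤ Real.exp T := by
    have := Real.quadratic_le_exp_of_nonneg hT0.le
    nlinarith
  have hexp4 : T ^ 2 ≤ Real.exp T := by
    have h := Real.quadratic_le_exp_of_nonneg (by linarith : 0 ≤ T / 2)
    have h1 : (T / 2) ^ 2 / 2 ≤ Real.exp (T / 2) := by nlinarith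
    have h2 : Real.exp T = Real.exp (T / 2) ^ 2 := by
      rw [sq, ← Real.exp_add]; ring_nf
    have h3 : ((T / 2) ^ 2 / 2) ^ 2 ≤ Real.exp (T / 2) ^ 2 :=
      pow_le_pow_left₀ (by positivity) h1 2
    rw [h2]
    nlinarith
  have hexpT : Real.exp T ≤ Real.exp T * Real.log T :=
    le_mul_of_one_le_right (Real.exp_pos T).le hlogT
  refine ⟨h19, ?_, ?_, ?_, hexp4.trans hexpT⟩
  · -- from `|log T + 3| ≤ (1/24) |T^{1-θ}|`
    rw [Real.norm_eq_abs, Real.norm_eq_abs, abs_of_nonneg (by linarith),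
      abs_of_nonneg (Real.rpow_nonneg hT0.le _)] at hT
    have hTθ : 0 ≤ T ^ θ := Real.rpow_nonneg hT0.le θ
    calc 24 * T ^ θ * (Real.log T + 3) ≤ 24 * T ^ θ * (1 / 24 * T ^ (1 - θ)) :=
          mul_le_mul_of_nonneg_left hT (by positivity)
      _ = T ^ θ * T ^ (1 - θ) := by ring
      _ = T := by rw [← Real.rpow_add hT0, add_sub_cancel, Real.rpow_one]
  · nlinarith
  · nlinarith

/-- `log₂ w → ∞` along the integers. [folklore] -/
theorem tendsto_loglog_natCast :
    Tendsto (fun w : ℕ => Real.log (Real.log (w : ℝ))) atTop atTop :=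
  (Real.tendsto_log_atTop.comp Real.tendsto_log_atTop).comp tendsto_natCast_atTop_atTop

/-- **The side conditions of McCurley's construction, eventually in `w`** (`L = log w`,
`T = log₂ w`): `T ≥ 19`, `24 T^{(d+7)/(d+8)} (log T + 3) ≤ T`, `2(d+7) T ≤ L`,
`2(d+8) T ≤ L log T`, `T² ≤ L log T`, and Chebyshev's `w/(4 log w) ≤ π(w) − π(w/4)`.
[folklore] -/
theorem eventually_loglog (d : ℕ) :
    ∀ᶠ w : ℕ in atTop, 19 ≤ Real.log (Real.log w) ∧
      24 * Real.log (Real.log w) ^ (((d : ℝ) + 7) / ((d : ℝ) + 8)) *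
          (Real.log (Real.log (Real.log w)) + 3) ≤ Real.log (Real.log w) ∧
      2 * ((d : ℝ) + 7) * Real.log (Real.log w) ≤ Real.log w ∧
      2 * ((d : ℝ) + 8) * Real.log (Real.log w) ≤ Real.log w * Real.log (Real.log (Real.log w)) ∧
      Real.log (Real.log w) ^ 2 ≤ Real.log w * Real.log (Real.log (Real.log w)) ∧
      (w : ℝ) / (4 * Real.log w) ≤ (Nat.primeCounting w : ℝ) - Nat.primeCounting (w / 4) := by
  filter_upwards [tendsto_loglog_natCast.eventually (eventually_T d), eventually_ge_atTop 3,
    eventually_primeCounting_sub_quarter_ge] with w hw hw3 hπ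
  obtain ⟨h1, h2, h3, h4, h5⟩ := hw
  have hw3' : (3 : ℝ) ≤ w := by exact_mod_cast hw3
  have hlog : 0 < Real.log w := Real.log_pos (by linarith)
  rw [Real.exp_log hlog] at h3 h4 h5
  exact ⟨h1, h2, h3, h4, h5, hπ⟩

/-! ### Basic consequences of `T ≥ 19` -/

/-- From `T = log L ≥ 19` (`L = log w`): `0 < T`, `1 ≤ log T ≤ T`, `exp T = L`, `200 ≤ L`,
`exp L = w`, `2 ≤ w`. [folklore] -/
theorem basics {w : ℕ} {L T : ℝ} (hL : L = Real.log w) (hT : T = Real.log L) (hT19 : 19 ≤ T) :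
    0 < T ∧ 1 ≤ Real.log T ∧ Real.log T ≤ T ∧ Real.exp T = L ∧ 200 ≤ L ∧
      Real.exp L = w ∧ (200 : ℝ) ≤ w := by
  have hT0 : 0 < T := by linarith
  have he := Real.exp_one_lt_d9
  have he' := Real.exp_one_gt_d9
  have hlogT : 1 ≤ Real.log T := by
    rw [← Real.log_exp 1]
    exact Real.log_le_log (Real.exp_pos 1) (by linarith)
  have hL0 : 0 < L := by
    have hLnn : 0 ≤ L := by rw [hL]; exact Real.log_natCast_nonneg w
    rcases hLnn.eq_or_lt with h | h
    · exfalso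
      have : T = 0 := by rw [hT, ← h, Real.log_zero]
      linarith
    · exact h
  have hexpT : Real.exp T = L := by rw [hT, Real.exp_log hL0]
  have hL200 : 200 ≤ L := by
    -- `L = exp T ≥ exp 19 ≥ 1 + 19 + 19²/2 > 200`
    rw [← hexpT]
    have := Real.quadratic_le_exp_of_nonneg hT0.le
    nlinarith
  have hw0 : (0 : ℝ) < w := by
    by_contra h
    push Not at h
    have : L ≤ 0 := by
      rw [hL]
      rcases eq_or_lt_of_le h with h' | h'
      · rw [h', Real.log_zero]
      · linarith [(Nat.cast_nonneg w : (0 : ℝ) ≤ w)]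
    linarith
  have hexpL : Real.exp L = w := by rw [hL, Real.exp_log hw0]
  have hw200 : (200 : ℝ) ≤ w := by
    rw [← hexpL]
    have := Real.quadratic_le_exp_of_nonneg (by linarith : (0 : ℝ) ≤ L)
    nlinarith
  exact ⟨hT0, hlogT, Real.log_le_self hT0.le, hexpT, hL200, hexpL, hw200⟩

/-! ### The length `F = (w/T)(L log T/T)^d` -/

/-- **Size of `F`.** Under `T ≥ 19` and `T² ≤ L log T`: `w ≤ F`, `0 < F` and
`log F ≤ L + d T` (`log F = L − log T + d (T + log log T − log T)`). [folklore] -/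
theorem F_bounds {d : ℕ} (hd : 1 ≤ d) {w : ℕ} {L T F : ℝ} (hL : L = Real.log w)
    (hT : T = Real.log L) (hT19 : 19 ≤ T) (h5 : T ^ 2 ≤ L * Real.log T)
    (hF : F = (w : ℝ) / T * (L * Real.log T / T) ^ d) :
    (w : ℝ) ≤ F ∧ 0 < F ∧ Real.log F ≤ L + d * T := by
  obtain ⟨hT0, hlogT1, hlogTT, hexpT, hL200, hexpL, hw200⟩ := basics hL hT hT19
  have hw0 : (0 : ℝ) < w := by linarith
  have hL0 : 0 < L := by linarith
  have hlogT0 : 0 < Real.log T := by linarith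
  have hX : 0 < L * Real.log T / T := by positivity
  -- `L log T / T ≥ T ≥ 1`
  have hX1 : T ≤ L * Real.log T / T := by
    rw [le_div_iff₀ hT0]; nlinarith
  have hXd : L * Real.log T / T ≤ (L * Real.log T / T) ^ d := by
    calc L * Real.log T / T = (L * Real.log T / T) ^ 1 := (pow_one _).symm
      _ ≤ (L * Real.log T / T) ^ d := pow_le_pow_right₀ (by linarith) hd
  have hFpos : 0 < F := by rw [hF]; positivity
  refine ⟨?_, hFpos, ?_⟩
  · rw [hF]
    calc (w : ℝ) = (w : ℝ) / T * T := by field_simp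
      _ ≤ (w : ℝ) / T * (L * Real.log T / T) :=
          mul_le_mul_of_nonneg_left hX1 (by positivity)
      _ ≤ (w : ℝ) / T * (L * Real.log T / T) ^ d :=
          mul_le_mul_of_nonneg_left hXd (by positivity)
  · rw [hF, Real.log_mul (by positivity) (by positivity), Real.log_div hw0.ne' hT0.ne',
      Real.log_pow, Real.log_div (by positivity) hT0.ne', Real.log_mul hL0.ne' hlogT0.ne',
      ← hL, ← hT]
    have hll : Real.log (Real.log T) ≤ Real.log T := Real.log_le_self hlogT0.le
    have hd0 : (0 : ℝ) ≤ d := Nat.cast_nonneg d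
    nlinarith

/-! ### The smooth part (`S₁`) -/

/-- **Rankin's exponent and the smooth part.** Let `T = log L ≥ 19` satisfy
`24 T^θ (log T + 3) ≤ T` (`θ = (d+7)/(d+8)`) and `2(d+7) T ≤ L`; put `η = (d+7) T/L`,
`ℓ = L log T/((d+8) T)`, and let `F ≥ e^L` with `log F ≤ L + d T`. Then `0 < η ≤ 1/2` and for
every `2 ≤ k ≤ e^ℓ + 1`,
`F^{1−η} exp(4(log log k + 4) + 4 η k^η (log k + 2)) ≤ e^L/(16 L)`.
(With `L = log w`, `k = y + 1`: the `y`-smooth numbers up to `u ≤ F` are at most `w/(16 log w)`,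
by `Literature.NumberTheory.Sieve.card_smoothNumbersUpTo_le_rankin_exp`; McCurley bounds `S₁ = Ψ(u, y)` by
de Bruijn's theorem instead.) [cite: McCurley1986SmallestPrimeValue, §4 (p. 933)] -/
theorem smoothFactor_le {d : ℕ} {L T η ℓ F k : ℝ} (hT : T = Real.log L) (hT19 : 19 ≤ T)
    (hb : 24 * T ^ (((d : ℝ) + 7) / ((d : ℝ) + 8)) * (Real.log T + 3) ≤ T)
    (hηL : 2 * ((d : ℝ) + 7) * T ≤ L)
    (hη : η = ((d : ℝ) + 7) * T / L) (hℓ : ℓ = L * Real.log T / (((d : ℝ) + 8) * T))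
    (hWF : Real.exp L ≤ F) (hF : Real.log F ≤ L + d * T)
    (hk2 : 2 ≤ k) (hk : k ≤ Real.exp ℓ + 1) :
    0 < η ∧ η ≤ 1 / 2 ∧
      F ^ (1 - η) * Real.exp (4 * (Real.log (Real.log k) + 4) + 4 * (η * k ^ η * (Real.log k + 2))) ≤
        Real.exp L / (16 * L) := by
  set θ : ℝ := ((d : ℝ) + 7) / ((d : ℝ) + 8) with hθ
  have hd0 : (0 : ℝ) ≤ d := Nat.cast_nonneg d
  have hT0 : 0 < T := by linarith
  have hL0 : 0 < L := by nlinarith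
  have hexpT : Real.exp T = L := by rw [hT, Real.exp_log hL0]
  have he := Real.exp_one_lt_d9
  have he' := Real.exp_one_gt_d9
  have hlogT1 : 1 ≤ Real.log T := by
    rw [← Real.log_exp 1]
    exact Real.log_le_log (Real.exp_pos 1) (by linarith)
  have hlogT0 : 0 < Real.log T := by linarith
  have hlogTT : Real.log T ≤ T := Real.log_le_self hT0.le
  have hθ0 : 0 < θ := by rw [hθ]; positivity
  have hθ1 : θ ≤ 1 := by rw [hθ, div_le_one (by linarith)]; linarith
  -- `η`
  have hη0 : 0 < η := by rw [hη]; positivity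
  have hη2 : η ≤ 1 / 2 := by
    rw [hη, div_le_iff₀ hL0]; linarith
  -- `ℓ`
  have hℓ0 : 0 < ℓ := by rw [hℓ]; positivity
  have hlogT2 : Real.log T ≤ T / 2 := by
    have h1 : T ≤ Real.exp (T / 2) := by
      have := Real.quadratic_le_exp_of_nonneg (by linarith : 0 ≤ T / 2)
      nlinarith
    calc Real.log T ≤ Real.log (Real.exp (T / 2)) := Real.log_le_log hT0 h1
      _ = T / 2 := Real.log_exp _
  have hℓL : ℓ ≤ L / 9 := by
    have h1 : Real.log T * 9 ≤ ((d : ℝ) + 8) * T := by nlinarith [mul_nonneg hd0 hT0.le]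
    rw [hℓ, div_le_div_iff₀ (by positivity) (by norm_num)]
    calc L * Real.log T * 9 = L * (Real.log T * 9) := by ring
      _ ≤ L * (((d : ℝ) + 8) * T) := mul_le_mul_of_nonneg_left h1 hL0.le
  have hL266 : 266 ≤ L := by nlinarith
  have hηℓ : η * ℓ = θ * Real.log T := by
    rw [hη, hℓ, hθ]; field_simp
  -- `k`
  have hk0 : 0 < k := by linarith
  have hlogk0 : 0 < Real.log k := Real.log_pos (by linarith)
  have hexpℓ : Real.exp ℓ + 1 ≤ Real.exp (ℓ + 1) := by
    rw [Real.exp_add]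
    have : 1 ≤ Real.exp ℓ := Real.one_le_exp hℓ0.le
    nlinarith
  have hlogk : Real.log k ≤ ℓ + 1 := by
    calc Real.log k ≤ Real.log (Real.exp (ℓ + 1)) := Real.log_le_log hk0 (hk.trans hexpℓ)
      _ = ℓ + 1 := Real.log_exp _
  have hloglogk : Real.log (Real.log k) ≤ T := by
    calc Real.log (Real.log k) ≤ Real.log (ℓ + 1) := Real.log_le_log hlogk0 hlogk
      _ ≤ Real.log L := Real.log_le_log (by linarith) (by linarith)
      _ = T := hT.symm
  -- `k^η ≤ 3 T^θ`
  have hkη : k ^ η ≤ 3 * T ^ θ := by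
    have h1 : k ^ η = Real.exp (η * Real.log k) := by
      rw [Real.rpow_def_of_pos hk0, mul_comm]
    have h2 : η * Real.log k ≤ θ * Real.log T + η := by
      calc η * Real.log k ≤ η * (ℓ + 1) := mul_le_mul_of_nonneg_left hlogk hη0.le
        _ = θ * Real.log T + η := by rw [mul_add, hηℓ, mul_one]
    have h3 : Real.exp (θ * Real.log T) = T ^ θ := by
      rw [Real.rpow_def_of_pos hT0, mul_comm]
    have h4 : Real.exp η ≤ 3 := by
      calc Real.exp η ≤ Real.exp 1 := Real.exp_le_exp.2 (by linarith)
        _ ≤ 3 := by linarith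
    calc k ^ η = Real.exp (η * Real.log k) := h1
      _ ≤ Real.exp (θ * Real.log T + η) := Real.exp_le_exp.2 h2
      _ = T ^ θ * Real.exp η := by rw [Real.exp_add, h3]
      _ ≤ T ^ θ * 3 := mul_le_mul_of_nonneg_left h4 (Real.rpow_nonneg hT0.le θ)
      _ = 3 * T ^ θ := by ring
  -- the exponent of the Euler-product bound is `≤ 5T + 16`
  have hTθ : 0 ≤ T ^ θ := Real.rpow_nonneg hT0.le θ
  have hE2 : η * k ^ η * (Real.log k + 2) ≤ T / 8 := by
    have h1 : η * k ^ η * (Real.log k + 2) ≤ η * (3 * T ^ θ) * (ℓ + 3) := by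
      have ha : η * k ^ η ≤ η * (3 * T ^ θ) := mul_le_mul_of_nonneg_left hkη hη0.le
      have hb' : 0 ≤ η * k ^ η := mul_nonneg hη0.le (Real.rpow_nonneg hk0.le η)
      calc η * k ^ η * (Real.log k + 2) ≤ η * k ^ η * (ℓ + 3) :=
            mul_le_mul_of_nonneg_left (by linarith) hb'
        _ ≤ η * (3 * T ^ θ) * (ℓ + 3) := mul_le_mul_of_nonneg_right ha (by linarith)
    have h2 : η * (3 * T ^ θ) * (ℓ + 3) = 3 * T ^ θ * (θ * Real.log T + 3 * η) := by
      rw [← hηℓ]; ring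
    have h3 : θ * Real.log T + 3 * η ≤ Real.log T + 3 := by
      have : θ * Real.log T ≤ 1 * Real.log T := mul_le_mul_of_nonneg_right hθ1 hlogT0.le
      linarith
    calc η * k ^ η * (Real.log k + 2) ≤ 3 * T ^ θ * (θ * Real.log T + 3 * η) := by rw [← h2]; exact h1
      _ ≤ 3 * T ^ θ * (Real.log T + 3) := mul_le_mul_of_nonneg_left h3 (by positivity)
      _ ≤ T / 8 := by linarith
  have hE : 4 * (Real.log (Real.log k) + 4) + 4 * (η * k ^ η * (Real.log k + 2)) ≤ 5 * T + 16 := by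
    linarith
  -- `F^{1-η} ≤ exp (L - 7T)`
  have hFpos : 0 < F := lt_of_lt_of_le (Real.exp_pos L) hWF
  have hlogF : L ≤ Real.log F := by
    calc L = Real.log (Real.exp L) := (Real.log_exp L).symm
      _ ≤ Real.log F := Real.log_le_log (Real.exp_pos L) hWF
  have hηL' : η * L = ((d : ℝ) + 7) * T := by rw [hη]; field_simp
  have hpow : F ^ (1 - η) ≤ Real.exp (L - 7 * T) := by
    rw [Real.rpow_def_of_pos hFpos]
    refine Real.exp_le_exp.2 ?_
    have h1 : η * L ≤ η * Real.log F := mul_le_mul_of_nonneg_left hlogF hη0.le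
    nlinarith
  -- assemble
  refine ⟨hη0, hη2, ?_⟩
  have hlog16 : Real.log 16 ≤ 3 := by
    have h16 : Real.log 16 = 4 * Real.log 2 := by
      rw [show (16 : ℝ) = 2 ^ 4 by norm_num, Real.log_pow]; ring
    have := Real.log_two_lt_d9
    rw [h16]; linarith
  calc F ^ (1 - η) * Real.exp (4 * (Real.log (Real.log k) + 4) + 4 * (η * k ^ η * (Real.log k + 2)))
      ≤ Real.exp (L - 7 * T) * Real.exp (5 * T + 16) :=
        mul_le_mul hpow (Real.exp_le_exp.2 hE) (Real.exp_pos _).le (Real.exp_pos _).le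
    _ = Real.exp (L - 2 * T + 16) := by rw [← Real.exp_add]; ring_nf
    _ ≤ Real.exp (L - T - Real.log 16) := Real.exp_le_exp.2 (by linarith)
    _ = Real.exp L / (16 * L) := by
        rw [Real.exp_sub, Real.exp_sub, hexpT, Real.exp_log (by norm_num)]
        field_simp

/-- **The size of `ℓ = L log T/((d+8) T)`** (so that `y = ⌊e^ℓ⌋` has `log y ≍ log w log₃ w/log₂ w`):
under `T ≥ 19`, `L > 0` and `2(d+8) T ≤ L log T` one has `2 ≤ ℓ ≤ L/9`. [folklore] -/
theorem ell_bounds {d : ℕ} {L T ℓ : ℝ} (hT19 : 19 ≤ T) (hL0 : 0 < L)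
    (h4 : 2 * ((d : ℝ) + 8) * T ≤ L * Real.log T) (hℓ : ℓ = L * Real.log T / (((d : ℝ) + 8) * T)) :
    2 ≤ ℓ ∧ ℓ ≤ L / 9 := by
  have hd0 : (0 : ℝ) ≤ d := Nat.cast_nonneg d
  have hT0 : 0 < T := by linarith
  have hlogT2 : Real.log T ≤ T / 2 := by
    have h1 : T ≤ Real.exp (T / 2) := by
      have := Real.quadratic_le_exp_of_nonneg (by linarith : 0 ≤ T / 2)
      nlinarith
    calc Real.log T ≤ Real.log (Real.exp (T / 2)) := Real.log_le_log hT0 h1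
      _ = T / 2 := Real.log_exp _
  constructor
  · rw [hℓ, le_div_iff₀ (by positivity)]
    nlinarith [h4]
  · have h1 : Real.log T * 9 ≤ ((d : ℝ) + 8) * T := by nlinarith [mul_nonneg hd0 hT0.le]
    rw [hℓ, div_le_div_iff₀ (by positivity) (by norm_num)]
    calc L * Real.log T * 9 = L * (Real.log T * 9) := by ring
      _ ≤ L * (((d : ℝ) + 8) * T) := mul_le_mul_of_nonneg_left h1 hL0.le

end Literature.NumberTheory.Sieve.McCurley
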